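import Literature.Computability.QuantumComplexity.LetterControls
import Literature.Computability.QuantumComplexity.LetterTargets
import Literature.Computability.QuantumComplexity.GadgetAssemblyGen
import Literature.Computability.QuantumComplexity.PhaseGadgetAssemblyGen
import HarnessLib

/-!
# The word of one letter: five gadget words implementing the controlled AJL local gate

Topic `Literature/Computability/QuantumComplexity`; a step in the discharge of
`ajl_jonesApproxProblem_mem_PromiseBQP` (AJL Claim 4.1: the controlled local unitaries are applied
gate by gate, each to inverse-polynomial precision, Thm. 4.3). A **gadget kit** is the per-copy block of
ancillas shared by all gadgets — `k` averaging wires `as`, the Hadamard column/selector wire `cr`, the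
classical layout (registers, flags, scratch) of width `thrWd k`, reflection helpers `hs`, a dummy
wire `d0` — with its layout read through `useLayout kit ins` (inputs `as`, `cr`, then the wires `ins`
of the current use). For a letter (local embedding `e : Fin 6 ↪ Fin N`, Hadamard-test qubit `q`, table
bit `w`, sign `±`) the circuit `letterCircuit` concatenates the five OAA words (`rot₂ᴴ`, `rot₃ᴴ`, phase,
`rot₃`, `rot₂`); **`letterCircuit_implOn`**: on inputs clean on the kit it implements
`condOn (Sqw q w) (placeGate e (ajlLocalCore ±))` up to `4·9√(4/2^k) + 9√(8/2^k)`.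

## References

* D. Aharonov, V. Jones, Z. Landau, Algorithmica 55 (2009), Claim 4.1 and Thm. 4.3
  [AharonovJonesLandau2009].
* D. W. Berry, A. M. Childs, R. Cleve, R. Kothari, R. D. Somma, STOC 2014, Lemma 3.1 [BerryEtAl2014].
-/

noncomputable section

namespace Literature.Computability.QuantumComplexity

open Literature.Computability.Complexity (bitsToNat bitsToNat_cons)
open Literature.Computability.Complexity.Com (testBit_bitsToNat)

open _root_.Matrix Finset Cryptography RevSim
open scoped Matrix.Norms.L2Operator

variable {N : ℕ}

/-! ### Small generic facts -/

/-- Supports in an intersection are preserved when both are. [folklore] -/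
theorem PreservesSupp.inter {P₁ P₂ : Set (QReg N)} {U : Matrix (QReg N) (QReg N) ℂ} (h₁ : PreservesSupp P₁ U)
    (h₂ : PreservesSupp P₂ U) : PreservesSupp (P₁ ∩ P₂) U := fun ψ hψ x hx => by
  rcases not_and_or.1 hx with hx | hx
  · exact h₁ ψ (fun y hy => hψ y fun h => hy h.1) x hx
  · exact h₂ ψ (fun y hy => hψ y fun h => hy h.2) x hx

/-- A label-controlled scalar is a diagonal matrix. [folklore] -/
theorem ctrlGate_smul_one (t : Fin N) (u : QReg N → ℂ) :
    ctrlGate t (fun z => u z • (1 : Matrix (QReg 1) (QReg 1) ℂ)) = Matrix.diagonal u := by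
  ext x z
  rw [ctrlGate_apply, Matrix.diagonal_apply]
  by_cases h : EqOff [t] z x
  · rw [if_pos h, Matrix.smul_apply, Matrix.one_apply, smul_eq_mul]
    by_cases hxz : x = z
    · subst hxz; simp
    · rw [if_neg hxz, if_neg, mul_zero]
      intro htt; apply hxz
      have := eqOff_singleton_iff.1 h
      rw [← show x t = z t from congrFun htt 0, Function.update_eq_self] at this
      exact this.symm
  · rw [if_neg h, if_neg]; rintro rfl; exact h (eqOff_refl _)

/-- A diagonal of unit scalars is unitary. [folklore] -/
theorem diagonal_mem_unitaryGroup_of_norm_eq_one {u : QReg N → ℂ} (hu : ∀ z, ‖u z‖ = 1) :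
    Matrix.diagonal u ∈ Matrix.unitaryGroup (QReg N) ℂ := by
  rw [Matrix.mem_unitaryGroup_iff, Matrix.star_eq_conjTranspose, Matrix.diagonal_conjTranspose, Matrix.diagonal_mul_diagonal,
    ← Matrix.diagonal_one]
  congr 1; funext z
  rw [Pi.star_apply, Complex.star_def, Complex.mul_conj, Complex.normSq_eq_norm_sq, hu]; norm_num

/-- A diagonal of unit scalars is a contraction. [folklore] -/
theorem isContraction_diagonal_of_norm_eq_one {u : QReg N → ℂ} (hu : ∀ z, ‖u z‖ = 1) : IsContraction (Matrix.diagonal u) :=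
  isContraction_of_mem_unitaryGroup (diagonal_mem_unitaryGroup_of_norm_eq_one hu)

/-- A diagonal matrix preserves every support. [folklore] -/
theorem preservesSupp_diagonal (P : Set (QReg N)) (u : QReg N → ℂ) : PreservesSupp P (Matrix.diagonal u) :=
  fun ψ hψ x hx => by rw [Matrix.mulVec_diagonal, hψ x hx, mul_zero]

/-- Updating a big label on an embedded wire, read back along the embedding. [folklore] -/
theorem update_comp_emb {k : ℕ} (e : Fin k ↪ Fin N) (z : QReg N) (j : Fin k) (b : Bool) :
    Function.update z (e j) b ∘ e = Function.update (z ∘ e) j b :=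
  Function.update_comp_eq_of_injective _ e.injective _ _

/-- `hiNum` with a distinguished first further input. [folklore] -/
theorem hiNum_cons (bb : Bool) (z : QReg N) (t : Fin N) (ins : List (Fin N)) :
    hiNum bb z (t :: ins) = SLP.hiOf bb (z t) (bitsToNat (ins.map z)) := by
  simp only [hiNum, bitsToNat, List.map_cons, SLP.hiOf]; ring

/-! ### The flag programs of a letter -/

namespace SLP

/-- **The sign program of a rotation gadget**: `z = 2, 3` selects `G₂`/`G₃`, `sgn = ±1` the gate or its
adjoint; block-encoding `−G`. Entries: `G₂ = [[1/φ, −1/√φ], [1/√φ, 1/φ]]`, `G₃ = [[1/√φ, −1/φ], [1/φ, 1/√φ]]`.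
[cite: AharonovJonesLandau2009, Claim 4.1] -/
def bRot (k : ℕ) (z : ℤ) (sgn : ℤ) : BExpr :=
  if z = 2 then
    (if sgn = 1 then rotSignB k (ctlRotB k 2) (.not (thr1B k)) (.not (thr2B k)) (thr2B k)
      else rotSignB k (ctlRotB k 2) (.not (thr1B k)) (thr2B k) (.not (thr2B k)))
  else
    (if sgn = 1 then rotSignB k (ctlRotB k 3) (.not (thr2B k)) (.not (thr1B k)) (thr1B k)
      else rotSignB k (ctlRotB k 3) (.not (thr2B k)) (thr1B k) (.not (thr1B k)))

/-- **The sign program of the phase gadget** (`±`), block-encoding `−c_±`. [cite: AharonovJonesLandau2009, Claim 4.1] -/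
def bPhase (k : ℕ) (positive : Bool) : BExpr :=
  phaseSignB k (ctlPhaseB k) (.not (thr4B k)) (if positive then .not (thr5B k) else thr5B k)

/-- The programs used by a letter. [folklore] -/
def letterPrograms (k : ℕ) : List BExpr := [bRot k 2 1, bRot k 2 (-1), bRot k 3 1, bRot k 3 (-1), bPhase k true, bPhase k false]

/-! #### Side conditions and widths of the letter programs -/

/-- `maxBnd` of `iteB` below a bound. [folklore] -/
theorem maxBnd_iteB_lt {M : ℕ} {c x y : BExpr} (hc : c.maxBnd < M) (hx : x.maxBnd < M) (hy : y.maxBnd < M) : (iteB c x y).maxBnd < M := by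
  simp only [iteB, BExpr.maxBnd, max_lt_iff]; exact ⟨⟨hc, hx⟩, hc, hy⟩

/-- `maxBnd` of a literal. [folklore] -/
theorem maxBnd_litB (off : ℕ) (v : Bool) : (litB off v).maxBnd = 2 := by
  unfold litB; cases v <;> simp [BExpr.maxBnd, bitB_maxBnd]

/-- `maxBnd` of a conjunction of literals. [folklore] -/
theorem maxBnd_conjB : ∀ (base : ℕ) (vs : List Bool), (conjB base vs).maxBnd = 2
  | base, [] => by simp [conjB, trueB, BExpr.maxBnd, bitB_maxBnd]
  | base, [v] => by rw [conjB, maxBnd_litB]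
  | base, v :: w :: vs => by rw [conjB, BExpr.maxBnd, maxBnd_litB, maxBnd_conjB]; rfl

/-- `OK` of `iteB`. [folklore] -/
theorem ok_iteB {Wd kIn : ℕ} {c x y : BExpr} (hc : c.OK Wd kIn) (hx : x.OK Wd kIn) (hy : y.OK Wd kIn) : (iteB c x y).OK Wd kIn :=
  ⟨⟨hc, hx⟩, hc, hy⟩

/-- `OK` of a literal. [folklore] -/
theorem ok_litB {Wd kIn off : ℕ} (h : off < kIn) (hW : 1 ≤ Wd) (v : Bool) : (litB off v).OK Wd kIn := by
  unfold litB; cases v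
  · exact bitB_ok h hW
  · exact bitB_ok h hW

/-- `OK` of a conjunction of literals. [folklore] -/
theorem ok_conjB {Wd kIn : ℕ} (hW : 1 ≤ Wd) : ∀ (base : ℕ) (vs : List Bool), base + vs.length ≤ kIn → 0 < kIn → (conjB base vs).OK Wd kIn
  | base, [], _, h0 => by simp only [conjB, trueB]; exact ⟨bitB_ok h0 hW, bitB_ok h0 hW⟩
  | base, [v], h, _ => ok_litB (by simp at h; omega) hW v
  | base, v :: w :: vs, h, h0 => ⟨ok_litB (by simp at h; omega) hW v, ok_conjB hW (base + 1) (w :: vs) (by simp at h ⊢; omega) h0⟩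

/-- **Widths of the letter programs**: all intermediate values fit in `thrWd k` bits. [folklore] -/
theorem maxBnd_letterProgram_lt (k : ℕ) : ∀ b ∈ letterPrograms k, b.maxBnd < 2 ^ thrWd k := by
  obtain ⟨h0, h1, h2, h3, h4, h5, h6⟩ := thrB_maxBnd_lt k
  have h2' : (2 : ℕ) < 2 ^ thrWd k :=
    calc (2 : ℕ) < 2 ^ 2 := by norm_num
      _ ≤ 2 ^ thrWd k := Nat.pow_le_pow_right (by norm_num) (by unfold thrWd; omega)
  have hc : ∀ z, (ctlRotB k z).maxBnd < 2 ^ thrWd k := fun z => by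
    unfold ctlRotB; split_ifs <;> (rw [maxBnd_conjB]; exact h2')
  have hcp : (ctlPhaseB k).maxBnd < 2 ^ thrWd k := by
    simp only [ctlPhaseB, BExpr.maxBnd, maxBnd_conjB, max_lt_iff]; exact ⟨h2', ⟨h2', h2'⟩, h2', h2'⟩
  have hb : (bitB k).maxBnd < 2 ^ thrWd k ∧ (bitB (k + 1)).maxBnd < 2 ^ thrWd k := by
    rw [bitB_maxBnd, bitB_maxBnd]; exact ⟨h2', h2'⟩
  have ht : (trueB k).maxBnd < 2 ^ thrWd k := by simp only [trueB, BExpr.maxBnd, max_lt_iff]; exact ⟨hb.1, hb.1⟩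
  have hrot : ∀ (ctl pd p10 p01 : BExpr), ctl.maxBnd < 2 ^ thrWd k → pd.maxBnd < 2 ^ thrWd k → p10.maxBnd < 2 ^ thrWd k →
      p01.maxBnd < 2 ^ thrWd k → (rotSignB k ctl pd p10 p01).maxBnd < 2 ^ thrWd k := fun ctl pd p10 p01 a b c d =>
    maxBnd_iteB_lt a (maxBnd_iteB_lt hb.1 (maxBnd_iteB_lt hb.2 d c) b) (maxBnd_iteB_lt hb.1 h0 ht)
  have hph : ∀ (pre pim : BExpr), pre.maxBnd < 2 ^ thrWd k → pim.maxBnd < 2 ^ thrWd k → (phaseSignB k (ctlPhaseB k) pre pim).maxBnd < 2 ^ thrWd k :=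
    fun pre pim a b => maxBnd_iteB_lt hcp (maxBnd_iteB_lt hb.1 b a) (maxBnd_iteB_lt hb.1 h0 ht)
  intro b hb'
  simp only [letterPrograms, List.mem_cons, List.not_mem_nil, or_false] at hb'
  rcases hb' with rfl | rfl | rfl | rfl | rfl | rfl
  · exact hrot _ _ _ _ (hc 2) h1 h2 h2
  · exact hrot _ _ _ _ (hc 2) h1 h2 h2
  · simp only [bRot, show ¬ (3 : ℤ) = 2 by norm_num, if_false, if_true]; exact hrot _ _ _ _ (hc 3) h2 h1 h1
  · simp only [bRot, show ¬ (3 : ℤ) = 2 by norm_num, if_false, show ¬ (-1 : ℤ) = 1 by norm_num]; exact hrot _ _ _ _ (hc 3) h2 h1 h1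
  · exact hph _ _ h4 h5
  · exact hph _ _ h4 h5

/-- **Side conditions of the letter programs**: rotation programs read `k + 9` input bits, phase
programs `k + 10`. [folklore] -/
theorem ok_letterProgram (k : ℕ) :
    (∀ (z sgn : ℤ), (bRot k z sgn).OK (thrWd k) (k + 1 + 8)) ∧ ∀ pos, (bPhase k pos).OK (thrWd k) (k + 1 + 9) := by
  have hW : 1 ≤ thrWd k := by unfold thrWd; omega
  obtain ⟨o0, o1, o2, -, -, -, -⟩ := thrB_ok k (kIn := k + 1 + 8) (by omega)
  obtain ⟨o0', -, -, -, o4', o5', -⟩ := thrB_ok k (kIn := k + 1 + 9) (by omega)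
  have hc : ∀ z, (ctlRotB k z).OK (thrWd k) (k + 1 + 8) := fun z => by
    unfold ctlRotB; split_ifs <;> exact ok_conjB hW _ _ (by simp) (by omega)
  have hcp : (ctlPhaseB k).OK (thrWd k) (k + 1 + 9) :=
    ⟨ok_conjB hW _ _ (by simp) (by omega), ⟨⟨ok_conjB hW _ _ (by simp) (by omega), ok_conjB hW _ _ (by simp) (by omega)⟩,
      ⟨ok_conjB hW _ _ (by simp) (by omega), ok_conjB hW _ _ (by simp) (by omega)⟩⟩⟩
  have hb8 : (bitB k).OK (thrWd k) (k + 1 + 8) ∧ (bitB (k + 1)).OK (thrWd k) (k + 1 + 8) := ⟨bitB_ok (by omega) hW, bitB_ok (by omega) hW⟩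
  have hb9 : (bitB k).OK (thrWd k) (k + 1 + 9) := bitB_ok (by omega) hW
  have ht8 : (trueB k).OK (thrWd k) (k + 1 + 8) := ⟨hb8.1, hb8.1⟩
  have ht9 : (trueB k).OK (thrWd k) (k + 1 + 9) := ⟨hb9, hb9⟩
  constructor
  · intro z sgn
    have hrot : ∀ (ctl pd p10 p01 : BExpr), ctl.OK (thrWd k) (k + 1 + 8) → pd.OK (thrWd k) (k + 1 + 8) → p10.OK (thrWd k) (k + 1 + 8) →
        p01.OK (thrWd k) (k + 1 + 8) → (rotSignB k ctl pd p10 p01).OK (thrWd k) (k + 1 + 8) := fun ctl pd p10 p01 a b c d =>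
      ok_iteB a (ok_iteB hb8.1 (ok_iteB hb8.2 d c) b) (ok_iteB hb8.1 o0 ht8)
    unfold bRot; split_ifs
    · exact hrot _ _ _ _ (hc 2) o1 o2 o2
    · exact hrot _ _ _ _ (hc 2) o1 o2 o2
    · exact hrot _ _ _ _ (hc 3) o2 o1 o1
    · exact hrot _ _ _ _ (hc 3) o2 o1 o1
  · intro pos
    unfold bPhase phaseSignB
    cases pos
    · exact ok_iteB hcp (ok_iteB hb9 o5' o4') (ok_iteB hb9 o0' ht9)
    · exact ok_iteB hcp (ok_iteB hb9 o5' o4') (ok_iteB hb9 o0' ht9)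

/-- `Re c_± = cos(3π/5)`, `Im c_± = ±sin(3π/5)`. [cite: AharonovJonesLandau2009, §2.13] -/
theorem ajlPhaseConst_re_im (positive : Bool) :
    (ajlPhaseConst positive).re = Real.cos (3 * Real.pi / 5) ∧
      (ajlPhaseConst positive).im = (if positive then 1 else -1) * Real.sin (3 * Real.pi / 5) := by
  cases positive
  · simp only [ajlPhaseConst, Bool.false_eq_true, if_false]
    rw [show (-(3 * Real.pi / 5 : ℝ) : ℂ) * Complex.I = ((-(3 * Real.pi / 5) : ℝ) : ℂ) * Complex.I by push_cast; ring,
      Complex.exp_ofReal_mul_I_re, Complex.exp_ofReal_mul_I_im, Real.cos_neg, Real.sin_neg]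
    exact ⟨rfl, by ring⟩
  · simp only [ajlPhaseConst, if_true]
    rw [Complex.exp_ofReal_mul_I_re, Complex.exp_ofReal_mul_I_im]; exact ⟨rfl, by ring⟩

/-- **The phase programs encode `−Re c_±`, `−Im c_±`.** [folklore] -/
theorem encodes_bPhase (k : ℕ) (positive : Bool) :
    EncodesEntry k (.not (thr4B k)) (-(ajlPhaseConst positive).re) ∧
      EncodesEntry k (if positive then .not (thr5B k) else thr5B k) (-(ajlPhaseConst positive).im) := by
  obtain ⟨hre, him⟩ := ajlPhaseConst_re_im positive
  rw [hre, him]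
  refine ⟨(encodesEntry_thr4B k).not, ?_⟩
  cases positive
  · simp only [Bool.false_eq_true, if_false, neg_mul, one_mul, neg_neg]; exact encodesEntry_thr5B k
  · simp only [if_true, one_mul]; exact (encodesEntry_thr5B k).not

end SLP

/-! ### Gadget kits -/

/-- **A gadget kit**: the per-copy ancillas shared by all gadgets. [folklore] -/
structure GadgetKit (N : ℕ) where
  /-- `0 < N` -/
  hN : 0 < N
  /-- number of averaging bits -/
  k : ℕ
  /-- the averaging wires -/
  as : List (Fin N)
  /-- the Hadamard column / selector wire -/
  cr : Fin N
  /-- base of the classical register block -/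
  rb : ℕ
  /-- base of the flag block -/
  fb : ℕ
  /-- base of the scratch blocks -/
  sb : ℕ
  /-- number of registers -/
  R : ℕ
  /-- number of flags -/
  F : ℕ
  /-- number of scratch blocks -/
  T : ℕ
  /-- reflection helpers -/
  hs : List (Fin N)
  /-- a dummy wire, never acted on -/
  d0 : Fin N

namespace GadgetKit

variable (kit : GadgetKit N)

/-- The classical width of the kit. [folklore] -/
abbrev Wd : ℕ := SLP.thrWd kit.k

/-- The layout of the kit reading `as`, `cr`, then the wires `ins`. [folklore] -/
def useLayout (ins : List (Fin N)) : SLP.Layout where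
  kIn := kit.k + 1 + ins.length
  rb := kit.rb
  fb := kit.fb
  sb := kit.sb
  iw j := if h : j < kit.as.length then (kit.as[j] : ℕ) else if j = kit.k then (kit.cr : ℕ) else ((ins.getD (j - (kit.k + 1)) kit.cr : Fin N) : ℕ)

/-- The region of the kit's layout (the same for every use). [folklore] -/
def region : List (Fin N) := layoutRegion kit.hN (kit.useLayout []) kit.R kit.F kit.T (Wd := kit.Wd)

/-- The clean-input condition of the kit: Hadamard wire, averaging wires, region and helpers clean. [folklore] -/
def P : Set (QReg N) := cleanOn (kit.cr :: kit.as ++ kit.region) ∩ cleanOn kit.hs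

/-- **Well-formedness of a kit.** [folklore] -/
structure OK : Prop where
  /-- `k` averaging wires -/
  len : kit.as.length = kit.k
  /-- Hadamard wires distinct -/
  nodup : (kit.cr :: kit.as).Nodup
  /-- Hadamard wires below the register block -/
  had_lt : ∀ a ∈ kit.cr :: kit.as, (a : ℕ) < kit.rb
  /-- the dummy wire below the register block and not a Hadamard wire -/
  d0_lt : (kit.d0 : ℕ) < kit.rb
  d0_notin : kit.d0 ∉ kit.cr :: kit.as
  /-- blocks in order and below `N` -/
  fb_ge : kit.rb + kit.R * kit.Wd ≤ kit.fb
  sb_ge : kit.fb + kit.F ≤ kit.sb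
  top_le : kit.sb + kit.T * SLP.scrSize kit.Wd ≤ N
  /-- helpers: as many as reflected wires, distinct, below the register block, not Hadamard wires -/
  hs_len : (kit.as ++ kit.region).length = kit.hs.length
  hs_ne : kit.hs ≠ []
  hs_nodup : kit.hs.Nodup
  hs_low : ∀ h ∈ kit.hs, (h : ℕ) < kit.rb
  hs_had : ∀ h ∈ kit.hs, h ∉ kit.cr :: kit.as
  hs_d0 : kit.d0 ∉ kit.hs
  /-- the register/flag/scratch bounds dominate the letter programs -/
  R_ge : ∀ b ∈ SLP.letterPrograms kit.k, (b.compile kit.Wd 0 0).2.2.1 ≤ kit.R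
  F_ge : ∀ b ∈ SLP.letterPrograms kit.k, (b.compile kit.Wd 0 0).2.2.2 ≤ kit.F
  T_ge : ∀ b ∈ SLP.letterPrograms kit.k, (b.compile kit.Wd 0 0).1.length ≤ kit.T


/-! ### Properties of a well-formed kit -/

section KitLemmas

variable {kit : GadgetKit N} (hk : kit.OK)
include hk

/-- Region wires are at or above the register base (as numbers) and below `N`. [folklore] -/
theorem region_val : ∀ x ∈ kit.region, kit.rb ≤ (x : ℕ) := by
  intro x hx
  simp only [region, layoutRegion, List.mem_map, List.mem_append, List.mem_range] at hx
  obtain ⟨v, hv, rfl⟩ := hx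
  have hfb := hk.fb_ge; have hsb := hk.sb_ge; have htop := hk.top_le
  have hvN : v < N ∧ kit.rb ≤ v := by
    rcases hv with (⟨i, hi, rfl⟩ | ⟨i, hi, rfl⟩) | ⟨i, hi, rfl⟩
    · simp only [useLayout]; constructor <;> nlinarith [Nat.zero_le (kit.T * SLP.scrSize kit.Wd)]
    · simp only [useLayout]; constructor <;> nlinarith [Nat.zero_le (kit.T * SLP.scrSize kit.Wd), Nat.zero_le (kit.R * kit.Wd)]
    · simp only [useLayout]; constructor <;> nlinarith [Nat.zero_le (kit.R * kit.Wd)]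
  rw [val_finOf_of_lt kit.hN hvN.1]; exact hvN.2

/-- Wires below the register base are not region wires. [folklore] -/
theorem not_mem_region_of_lt {x : Fin N} (hx : (x : ℕ) < kit.rb) : x ∉ kit.region := fun h => by
  have := region_val hk x h; omega

/-- The region has no duplicates. [folklore] -/
theorem region_nodup : kit.region.Nodup := by
  have hfb := hk.fb_ge; have hsb := hk.sb_ge; have htop := hk.top_le
  simp only [region, layoutRegion, useLayout]
  -- the underlying list of naturals is duplicate-free and below `N`
  have hlt : ∀ v ∈ (List.range (kit.R * kit.Wd)).map (fun i => kit.rb + i) ++ (List.range kit.F).map (fun i => kit.fb + i) ++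
      (List.range (kit.T * SLP.scrSize kit.Wd)).map (fun i => kit.sb + i), v < N := by
    intro v hv
    simp only [List.mem_append, List.mem_map, List.mem_range] at hv
    rcases hv with (⟨i, hi, rfl⟩ | ⟨i, hi, rfl⟩) | ⟨i, hi, rfl⟩ <;> omega
  refine List.Nodup.map_on (fun v hv v' hv' h => ?_) ?_
  · have := congrArg Fin.val h; rwa [val_finOf_of_lt kit.hN (hlt v hv), val_finOf_of_lt kit.hN (hlt v' hv')] at this
  · refine List.Nodup.append (List.Nodup.append ?_ ?_ ?_) ?_ ?_
    · exact (List.nodup_range).map_on fun a _ b _ h => by omega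
    · exact (List.nodup_range).map_on fun a _ b _ h => by omega
    · intro v h1 h2
      simp only [List.mem_map, List.mem_range] at h1 h2
      obtain ⟨i, hi, rfl⟩ := h1; obtain ⟨i', hi', h⟩ := h2; nlinarith
    · exact (List.nodup_range).map_on fun a _ b _ h => by omega
    · intro v h1 h2
      simp only [List.mem_append, List.mem_map, List.mem_range] at h1 h2
      obtain ⟨i', hi', rfl⟩ := h2
      rcases h1 with ⟨i, hi, h⟩ | ⟨i, hi, h⟩ <;> nlinarith

/-- Hadamard wires are not region wires. [folklore] -/
theorem had_not_region : ∀ a ∈ kit.cr :: kit.as, a ∉ kit.region := fun a ha => not_mem_region_of_lt hk (hk.had_lt a ha)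

/-- The reflected wires avoid the helpers and the seed. [folklore] -/
theorem hls : ∀ l ∈ kit.as ++ kit.region, l ∉ kit.hs ∧ l ≠ kit.cr := by
  intro l hl
  rw [List.mem_append] at hl
  have hnd := hk.nodup
  rcases hl with hl | hl
  · exact ⟨fun h => hk.hs_had l h (List.mem_cons_of_mem _ hl), fun e => (List.nodup_cons.1 hnd).1 (e ▸ hl)⟩
  · exact ⟨fun h => not_mem_region_of_lt hk (hk.hs_low l h) hl, fun e => had_not_region hk kit.cr (by simp) (e ▸ hl)⟩

/-- The reflected wires with the seed are duplicate-free. [folklore] -/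
theorem hlsnd : (kit.cr :: (kit.as ++ kit.region)).Nodup := by
  have hnd := hk.nodup
  rw [List.nodup_cons, List.mem_append, not_or]
  refine ⟨⟨(List.nodup_cons.1 hnd).1, had_not_region hk _ (by simp)⟩, ?_⟩
  exact List.Nodup.append (List.nodup_cons.1 hnd).2 (region_nodup hk) fun a ha hr => had_not_region hk a (List.mem_cons_of_mem _ ha) hr

/-- The reflection program of the kit is well formed. [folklore] -/
theorem hwfR : ∀ op ∈ reflectProg kit.cr (kit.as ++ kit.region) kit.hs, op.WF :=
  reflectProg_wf hk.hs_nodup (hk.hs_had kit.cr · (by simp)) (hls hk)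

/-- **The layout of a use of the kit is a gadget layout.** [folklore] -/
theorem gadgetLayout_useLayout {ins : List (Fin N)} (hnd : ins.Nodup) (hhad : ∀ i ∈ ins, i ∉ kit.cr :: kit.as)
    (hlt : ∀ i ∈ ins, (i : ℕ) < kit.rb) (hlen : ins.length ≤ 9) :
    GadgetLayout kit.hN (kit.useLayout ins) kit.Wd kit.R kit.F kit.T kit.k kit.as kit.cr ins := by
  have hlenk := hk.len
  have hnd' := hk.nodup
  have hcr : kit.cr ∉ kit.as := (List.nodup_cons.1 hnd').1
  -- the input wire map, case by case
  have iw_as : ∀ (j : ℕ) (hj : j < kit.as.length), (kit.useLayout ins).iw j = (kit.as[j] : ℕ) := fun j hj => by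
    simp only [useLayout, dif_pos hj]
  have iw_c : (kit.useLayout ins).iw kit.k = kit.cr := by
    simp only [useLayout, dif_neg (show ¬ kit.k < kit.as.length by omega), if_true]
  have iw_ins : ∀ (j : ℕ) (hj : j < ins.length), (kit.useLayout ins).iw (kit.k + 1 + j) = (ins[j] : ℕ) := fun j hj => by
    simp only [useLayout, dif_neg (show ¬ kit.k + 1 + j < kit.as.length by omega), if_neg (show kit.k + 1 + j ≠ kit.k by omega),
      show kit.k + 1 + j - (kit.k + 1) = j by omega, List.getD_eq_getElem?_getD, List.getElem?_eq_getElem hj, Option.getD_some]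
  -- every input wire, as a `Fin N`
  have iw_fin : ∀ j, j < kit.k + 1 + ins.length → ∃ x : Fin N, (kit.useLayout ins).iw j = (x : ℕ) ∧
      ((∃ (hj : j < kit.as.length), x = kit.as[j]) ∨ (j = kit.k ∧ x = kit.cr) ∨ (∃ (j' : ℕ) (hj' : j' < ins.length), j = kit.k + 1 + j' ∧ x = ins[j'])) := by
    intro j hj
    rcases Nat.lt_or_ge j kit.k with h | h
    · exact ⟨kit.as[j]'(by omega), iw_as j (by omega), Or.inl ⟨by omega, rfl⟩⟩
    · rcases Nat.lt_or_ge j (kit.k + 1) with h1 | h1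
      · have : j = kit.k := by omega
        subst this; exact ⟨kit.cr, iw_c, Or.inr (Or.inl ⟨rfl, rfl⟩)⟩
      · obtain ⟨j', rfl⟩ : ∃ j', j = kit.k + 1 + j' := ⟨j - (kit.k + 1), by omega⟩
        exact ⟨ins[j']'(by omega), iw_ins j' (by omega), Or.inr (Or.inr ⟨j', by omega, rfl, rfl⟩)⟩
  have iw_lt_rb : ∀ j, j < kit.k + 1 + ins.length → (kit.useLayout ins).iw j < kit.rb := by
    intro j hj
    obtain ⟨x, hx, hcase⟩ := iw_fin j hj
    rw [hx]
    rcases hcase with ⟨hj', rfl⟩ | ⟨-, rfl⟩ | ⟨j', hj', -, rfl⟩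
    · exact hk.had_lt _ (List.mem_cons_of_mem _ (List.getElem_mem hj'))
    · exact hk.had_lt _ (by simp)
    · exact hlt _ (List.getElem_mem hj')
  refine
    { below := ⟨⟨by show kit.k + 1 + ins.length ≤ SLP.thrWd kit.k; unfold SLP.thrWd; omega, iw_lt_rb, ?_, hk.fb_ge, hk.sb_ge⟩, hk.top_le,
        fun j hj => lt_of_lt_of_le (iw_lt_rb j hj) (by have := hk.fb_ge; have := hk.sb_ge; have := hk.top_le; nlinarith [Nat.zero_le (kit.R * kit.Wd), Nat.zero_le (kit.T * SLP.scrSize kit.Wd)])⟩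
      kIn := rfl
      len := hlenk
      iw_as := iw_as
      iw_c := iw_c
      iw_ins := iw_ins
      nodup := (List.nodup_cons.1 hnd').2
      c_notin := hcr
      ins_off := fun i hi => ⟨fun h => hhad i hi (List.mem_cons_of_mem _ h), fun h => hhad i hi (h ▸ List.mem_cons_self ..)⟩ }
  -- injectivity of the input wire map
  intro j j' hj hj' hjj
  change j < kit.k + 1 + ins.length at hj
  change j' < kit.k + 1 + ins.length at hj'
  obtain ⟨x, hx, hc⟩ := iw_fin j hj
  obtain ⟨x', hx', hc'⟩ := iw_fin j' hj'
  have hxx : x = x' := Fin.ext (by rw [← hx, ← hx', hjj])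
  subst hxx
  have has_nd : kit.as.Nodup := (List.nodup_cons.1 hnd').2
  rcases hc with ⟨h1, e1⟩ | ⟨rfl, e1⟩ | ⟨i1, hi1, rfl, e1⟩ <;> rcases hc' with ⟨h2, e2⟩ | ⟨rfl, e2⟩ | ⟨i2, hi2, rfl, e2⟩
  · exact (List.Nodup.getElem_inj_iff has_nd).1 (e1.symm.trans e2)
  · exact absurd (e2 ▸ e1 ▸ List.getElem_mem h1) hcr
  · exact absurd (List.mem_cons_of_mem _ (e1 ▸ List.getElem_mem h1)) (hhad _ (e2 ▸ List.getElem_mem hi2))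
  · exact absurd (e1 ▸ e2 ▸ List.getElem_mem h2) hcr
  · rfl
  · exact absurd (e1 ▸ List.mem_cons_self ..) (hhad _ (e2 ▸ List.getElem_mem hi2))
  · exact absurd (List.mem_cons_of_mem _ (e2 ▸ List.getElem_mem h2)) (hhad _ (e1 ▸ List.getElem_mem hi1))
  · exact absurd (e2 ▸ List.mem_cons_self ..) (hhad _ (e1 ▸ List.getElem_mem hi1))
  · have := (List.Nodup.getElem_inj_iff hnd).1 (e1.symm.trans e2); omega

omit hk in
/-- The region of any use is the kit's region. [folklore] -/
theorem layoutRegion_useLayout (ins : List (Fin N)) :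
    layoutRegion kit.hN (kit.useLayout ins) kit.R kit.F kit.T (Wd := kit.Wd) = kit.region := rfl

end KitLemmas


/-! ### The words of a letter -/

/-- **Well-placedness of a letter** relative to a kit: local wires, Hadamard-test qubit and table
bit are data wires (below the register block), off the Hadamard wires and helpers, mutually apart,
and apart from the dummy wire. [folklore] -/
structure LetterOK (kit : GadgetKit N) (e : Fin 6 ↪ Fin N) (q w : Fin N) : Prop where
  /-- local wires are data wires -/
  e_lt : ∀ j, (e j : ℕ) < kit.rb
  /-- the Hadamard-test qubit is a data wire -/
  q_lt : (q : ℕ) < kit.rb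
  /-- the table bit is a data wire -/
  w_lt : (w : ℕ) < kit.rb
  /-- local wires are not Hadamard wires -/
  e_had : ∀ j, e j ∉ kit.cr :: kit.as
  q_had : q ∉ kit.cr :: kit.as
  w_had : w ∉ kit.cr :: kit.as
  /-- … nor helpers -/
  e_hs : ∀ j, e j ∉ kit.hs
  q_hs : q ∉ kit.hs
  w_hs : w ∉ kit.hs
  /-- the control wires are not local wires, and distinct -/
  q_e : q ∉ Set.range e
  w_e : w ∉ Set.range e
  qw : q ≠ w
  /-- the dummy wire is apart -/
  d0_e : kit.d0 ∉ Set.range e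
  d0_q : kit.d0 ≠ q
  d0_w : kit.d0 ≠ w

section Letter

variable {kit : GadgetKit N} (hk : kit.OK) {e : Fin 6 ↪ Fin N} {q w : Fin N} (hL : LetterOK kit e q w)

/-- The further inputs of a rotation gadget: target `e 2`, controls `q`, `w`, then `e₀, e₁, e₃, e₄, e₅`. [folklore] -/
def insRot (e : Fin 6 ↪ Fin N) (q w : Fin N) : List (Fin N) := [e 2, q, w, e 0, e 1, e 3, e 4, e 5]

/-- The further inputs of the phase gadget: dummy `d0`, controls `q`, `w`, then `e₀, …, e₅`. [folklore] -/
def insPhase (kit : GadgetKit N) (e : Fin 6 ↪ Fin N) (q w : Fin N) : List (Fin N) := [kit.d0, q, w, e 0, e 1, e 2, e 3, e 4, e 5]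

include hL in
/-- The rotation inputs are admissible. [folklore] -/
theorem insRot_ok : (insRot e q w).Nodup ∧ (∀ i ∈ insRot e q w, i ∉ kit.cr :: kit.as) ∧ (∀ i ∈ insRot e q w, (i : ℕ) < kit.rb) ∧
    (insRot e q w).length ≤ 9 ∧ ∀ i ∈ insRot e q w, i ∉ kit.hs := by
  have hinj := e.injective
  have hq := hL.q_e; have hw := hL.w_e; have hqw := hL.qw
  simp only [Set.mem_range, not_exists] at hq hw
  refine ⟨?_, ?_, ?_, by simp [insRot], ?_⟩
  · have hq' : ∀ y, q ≠ e y := fun y h => hq y h.symm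
    have hw' : ∀ y, w ≠ e y := fun y h => hw y h.symm
    simp [insRot, hq, hw, hq', hw', hqw, hinj.eq_iff]
  · intro i hi; simp only [insRot, List.mem_cons, List.not_mem_nil, or_false] at hi
    rcases hi with rfl | rfl | rfl | rfl | rfl | rfl | rfl | rfl
    exacts [hL.e_had 2, hL.q_had, hL.w_had, hL.e_had 0, hL.e_had 1, hL.e_had 3, hL.e_had 4, hL.e_had 5]
  · intro i hi; simp only [insRot, List.mem_cons, List.not_mem_nil, or_false] at hi
    rcases hi with rfl | rfl | rfl | rfl | rfl | rfl | rfl | rfl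
    exacts [hL.e_lt 2, hL.q_lt, hL.w_lt, hL.e_lt 0, hL.e_lt 1, hL.e_lt 3, hL.e_lt 4, hL.e_lt 5]
  · intro i hi; simp only [insRot, List.mem_cons, List.not_mem_nil, or_false] at hi
    rcases hi with rfl | rfl | rfl | rfl | rfl | rfl | rfl | rfl
    exacts [hL.e_hs 2, hL.q_hs, hL.w_hs, hL.e_hs 0, hL.e_hs 1, hL.e_hs 3, hL.e_hs 4, hL.e_hs 5]

include hk hL in
/-- The phase inputs are admissible. [folklore] -/
theorem insPhase_ok : (insPhase kit e q w).Nodup ∧ (∀ i ∈ insPhase kit e q w, i ∉ kit.cr :: kit.as) ∧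
    (∀ i ∈ insPhase kit e q w, (i : ℕ) < kit.rb) ∧ (insPhase kit e q w).length ≤ 9 ∧ ∀ i ∈ insPhase kit e q w, i ∉ kit.hs := by
  have hinj := e.injective
  have hq := hL.q_e; have hw := hL.w_e; have hqw := hL.qw; have hd := hL.d0_e
  simp only [Set.mem_range, not_exists] at hq hw hd
  refine ⟨?_, ?_, ?_, by simp [insPhase], ?_⟩
  · have hq' : ∀ y, q ≠ e y := fun y h => hq y h.symm
    have hw' : ∀ y, w ≠ e y := fun y h => hw y h.symm
    have hd' : ∀ y, kit.d0 ≠ e y := fun y h => hd y h.symm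
    have h1 := hL.d0_q; have h2 := hL.d0_w
    simp [insPhase, hq', hw', hd', hqw, h1, h2, hinj.eq_iff]
  · intro i hi; simp only [insPhase, List.mem_cons, List.not_mem_nil, or_false] at hi
    rcases hi with rfl | rfl | rfl | rfl | rfl | rfl | rfl | rfl | rfl
    exacts [hk.d0_notin, hL.q_had, hL.w_had, hL.e_had 0, hL.e_had 1, hL.e_had 2, hL.e_had 3, hL.e_had 4, hL.e_had 5]
  · intro i hi; simp only [insPhase, List.mem_cons, List.not_mem_nil, or_false] at hi
    rcases hi with rfl | rfl | rfl | rfl | rfl | rfl | rfl | rfl | rfl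
    exacts [hk.d0_lt, hL.q_lt, hL.w_lt, hL.e_lt 0, hL.e_lt 1, hL.e_lt 2, hL.e_lt 3, hL.e_lt 4, hL.e_lt 5]
  · intro i hi; simp only [insPhase, List.mem_cons, List.not_mem_nil, or_false] at hi
    rcases hi with rfl | rfl | rfl | rfl | rfl | rfl | rfl | rfl | rfl
    exacts [hk.hs_d0, hL.q_hs, hL.w_hs, hL.e_hs 0, hL.e_hs 1, hL.e_hs 2, hL.e_hs 3, hL.e_hs 4, hL.e_hs 5]

/-- The rotation programs are among the letter programs. [folklore] -/
theorem bRot_mem (k : ℕ) {z sgn : ℤ} (hz : z = 2 ∨ z = 3) (hs : sgn = 1 ∨ sgn = -1) : SLP.bRot k z sgn ∈ SLP.letterPrograms k := by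
  rcases hz with rfl | rfl <;> rcases hs with rfl | rfl <;> simp [SLP.letterPrograms]

/-- The phase programs are among the letter programs. [folklore] -/
theorem bPhase_mem (k : ℕ) (pos : Bool) : SLP.bPhase k pos ∈ SLP.letterPrograms k := by
  unfold SLP.letterPrograms; cases pos <;> simp

/-- **The rotation predicate is a `rotSignB` with the right encodings** (`z = 2, 3`, `sgn = ±1`):
diagonal `a_z`, entry `sgn·b_z` at `(1,0)`, `−sgn·b_z` at `(0,1)`; block-encoding `−G`. [folklore] -/
theorem encodes_bRot (k : ℕ) {z : ℤ} (hz : z = 2 ∨ z = 3) {sgn : ℤ} (hs : sgn = 1 ∨ sgn = -1) :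
    ∃ pd p10 p01 : SLP.BExpr, SLP.bRot k z sgn = SLP.rotSignB k (SLP.ctlRotB k z) pd p10 p01 ∧
      SLP.EncodesEntry k pd (-(rotAmpA z)) ∧ SLP.EncodesEntry k p10 (-((sgn : ℝ) * rotAmpB z)) ∧
      SLP.EncodesEntry k p01 (-(-((sgn : ℝ) * rotAmpB z))) := by
  obtain ⟨hA2, hB2, hA3, hB3⟩ := rotAmp_values
  have e1 := SLP.encodesEntry_thr1B k
  have e2 := SLP.encodesEntry_thr2B k
  rcases hz with rfl | rfl <;> rcases hs with rfl | rfl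
  · refine ⟨.not (SLP.thr1B k), .not (SLP.thr2B k), SLP.thr2B k, by simp [SLP.bRot], ?_, ?_, ?_⟩
    · rw [hA2]; exact e1.not
    · rw [hB2]; push_cast; rw [one_mul]; exact e2.not
    · rw [hB2]; push_cast; rw [one_mul, neg_neg]; exact e2
  · refine ⟨.not (SLP.thr1B k), SLP.thr2B k, .not (SLP.thr2B k), by simp [SLP.bRot], ?_, ?_, ?_⟩
    · rw [hA2]; exact e1.not
    · rw [hB2]; push_cast; rw [neg_mul, one_mul, neg_neg]; exact e2
    · rw [hB2]; push_cast; rw [neg_mul, one_mul, neg_neg]; exact e2.not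
  · refine ⟨.not (SLP.thr2B k), .not (SLP.thr1B k), SLP.thr1B k, by simp [SLP.bRot], ?_, ?_, ?_⟩
    · rw [hA3]; exact e2.not
    · rw [hB3]; push_cast; rw [one_mul]; exact e1.not
    · rw [hB3]; push_cast; rw [one_mul, neg_neg]; exact e1
  · refine ⟨.not (SLP.thr2B k), SLP.thr1B k, .not (SLP.thr1B k), by simp [SLP.bRot], ?_, ?_, ?_⟩
    · rw [hA3]; exact e2.not
    · rw [hB3]; push_cast; rw [neg_mul, one_mul, neg_neg]; exact e1
    · rw [hB3]; push_cast; rw [neg_mul, one_mul, neg_neg]; exact e1.not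

/-- The vertex condition of the rotation gadget `z`. [folklore] -/
def condOf (z : ℤ) (x : QReg 6) : Prop := if z = 2 then Cond₂ x else Cond₃ x

/-- `condOf` is decidable. [folklore] -/
instance (z : ℤ) : DecidablePred (condOf z) := fun x => by unfold condOf; infer_instance

/-- `condOf` does not read the rotated bit. [folklore] -/
theorem condOf_update (z : ℤ) (x : QReg 6) (b : Bool) : condOf z (Function.update x 2 b) ↔ condOf z x := by
  unfold condOf; split_ifs; exacts [cond₂_update x b, cond₃_update x b]

/-- The control expression decides `q ∧ w ∧ condOf z` (`z = 2, 3`). [folklore] -/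
theorem ctlRotB_eval_condOf (k : ℕ) (e : Fin 6 ↪ Fin N) (q w : Fin N) (z' : QReg N) {z : ℤ} (hz : z = 2 ∨ z = 3) :
    (SLP.ctlRotB k z).eval (2 ^ (k + 2) * bitsToNat [z' q, z' w, z' (e 0), z' (e 1), z' (e 3), z' (e 4), z' (e 5)]) =
      decide (z' ∈ Sqw q w ∧ condOf z (z' ∘ e)) := by
  have h := SLP.ctlRotB_eval k e q w z'
  rcases hz with rfl | rfl
  · rw [h.1]; apply Bool.decide_congr; simp [condOf, and_assoc]
  · rw [h.2]; apply Bool.decide_congr; simp [condOf, and_assoc]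

/-! #### The rotation words -/

/-- The flag program of the rotation gadget `(z, sgn)` of the letter. [folklore] -/
def rotOps (kit : GadgetKit N) (e : Fin 6 ↪ Fin N) (q w : Fin N) (z sgn : ℤ) : List (ClOp (Fin N)) :=
  gadgetOps kit.hN (kit.useLayout (insRot e q w)) (SLP.bRot kit.k z sgn) (Wd := kit.Wd)

/-- Its flag wire. [folklore] -/
def rotFlag (kit : GadgetKit N) (e : Fin 6 ↪ Fin N) (q w : Fin N) (z sgn : ℤ) : Fin N :=
  gadgetFlag kit.hN (kit.useLayout (insRot e q w)) (SLP.bRot kit.k z sgn) (Wd := kit.Wd)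

include hk hL in
/-- The rotation flag program is well formed. [folklore] -/
theorem rotOps_wf {z sgn : ℤ} (hz : z = 2 ∨ z = 3) (hs : sgn = 1 ∨ sgn = -1) : ∀ op ∈ rotOps kit e q w z sgn, op.WF := by
  obtain ⟨hnd, hhad, hlt, hlen, -⟩ := insRot_ok hL
  exact gadgetOps_wf (gadgetLayout_useLayout hk hnd hhad hlt hlen) _ ((SLP.ok_letterProgram kit.k).1 z sgn)
    (hk.R_ge _ (bRot_mem _ hz hs)) (hk.F_ge _ (bRot_mem _ hz hs)) (hk.T_ge _ (bRot_mem _ hz hs))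

/-- **The word of the rotation gadget `(z, sgn)` of the letter.** [cite: AharonovJonesLandau2009, Claim 4.1] -/
def rotWord {z sgn : ℤ} (hz : z = 2 ∨ z = 3) (hs : sgn = 1 ∨ sgn = -1) : QCircuit cliffordT N :=
  oaaWordCircuit
    (sandwichCircuit (kit.cr :: kit.as) kit.cr (e 2) (fun h => hL.e_had 2 (h ▸ List.mem_cons_self ..)) (rotOps kit e q w z sgn)
      (rotOps_wf hk hL hz hs) [] [rotFlag kit e q w z sgn])
    (reflectCircuit kit.cr (kit.as ++ kit.region) kit.hs hk.hs_ne (hwfR hk))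

/-- The rotation gadget error. [folklore] -/
def rotErr (k : ℕ) : ℝ := 9 * Real.sqrt (2 * (2 / 2 ^ k))

include hk hL in
/-- **The rotation word is a good step** implementing `tgtRot e q w z (condOf z) sgn` on `kit.P`.
[cite: AharonovJonesLandau2009, Claim 4.1 and Thm. 4.3] -/
theorem rotWord_good {z : ℤ} (hz : z = 2 ∨ z = 3) {sgn : ℤ} (hs : sgn = 1 ∨ sgn = -1) :
    (⟨(rotWord hk hL hz hs).toMatrix 0, tgtRot e q w z (condOf z) (sgn : ℝ), rotErr kit.k⟩ : ApproxStep N).Good kit.P := by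
  obtain ⟨hnd, hhad, hlt, hlen, hhs⟩ := insRot_ok hL
  have G := gadgetLayout_useLayout hk hnd hhad hlt hlen
  have hok := (SLP.ok_letterProgram kit.k).1 z sgn
  have hR := hk.R_ge _ (bRot_mem kit.k hz hs); have hF := hk.F_ge _ (bRot_mem kit.k hz hs); have hT := hk.T_ge _ (bRot_mem kit.k hz hs)
  have hmax := SLP.maxBnd_letterProgram_lt kit.k _ (bRot_mem kit.k hz hs)
  obtain ⟨pd, p10, p01, hb, hd, h10, h01⟩ := encodes_bRot kit.k hz hs
  have hz14 : 1 ≤ z ∧ z ≤ 4 := by rcases hz with rfl | rfl <;> norm_num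
  have hsq : ((sgn : ℝ) * rotAmpB z) ^ 2 = rotAmpB z ^ 2 := by rcases hs with rfl | rfl <;> push_cast <;> ring
  -- the target block
  set U : QReg N → Matrix (QReg 1) (QReg 1) ℂ := fun x => if x ∈ Sqw q w ∧ condOf z (x ∘ e) then rot2x2 (rotAmpA z) ((sgn : ℝ) * rotAmpB z) else 1
    with hU
  have hUu : ∀ x, U x ∈ Matrix.unitaryGroup (QReg 1) ℂ := fun x => by
    simp only [hU]; split_ifs
    · exact rot2x2_mem_unitaryGroup (by rw [hsq]; exact rotAmp_sq_add_sq hz14)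
    · exact Submonoid.one_mem _
  have hUt : ∀ x b, U (Function.update x (e 2) b) = U x := fun x b => by
    simp only [hU, Sqw_update hL.q_e hL.w_e x 2 b, update_comp_emb, condOf_update]
  have ht2r : e 2 ∉ kit.region := not_mem_region_of_lt hk (hL.e_lt 2)
  -- helpers avoid the sandwich
  have hsw : ∀ h ∈ kit.hs, h ∉ sandwichWires (kit.cr :: kit.as) kit.cr (e 2) (rotOps kit e q w z sgn) [] [rotFlag kit e q w z sgn] := by
    intro h hh hmem
    simp only [sandwichWires, List.append_nil, List.mem_append, List.mem_flatMap] at hmem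
    rcases hmem with ((hm | hm) | ⟨op, hop, hx⟩) | hm
    · exact hk.hs_had h hh hm
    · simp only [List.mem_cons, List.not_mem_nil, or_false] at hm
      rcases hm with hm | hm
      · exact hk.hs_had h hh (by rw [hm]; exact List.mem_cons_self ..)
      · exact hL.e_hs 2 (by rw [← hm]; exact hh)
    · rcases mem_of_mem_wiresOf_gadgetOps G _ hok hR hF hT hop hx with hr | hr | hr | hr
      · exact not_mem_region_of_lt hk (hk.hs_low h hh) hr
      · exact hk.hs_had h hh (List.mem_cons_of_mem _ hr)
      · exact hk.hs_had h hh (by rw [hr]; exact List.mem_cons_self ..)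
      · exact hhs _ hr hh
    · rw [List.mem_singleton] at hm
      exact not_mem_region_of_lt hk (hk.hs_low _ hh) (by
        rw [hm]; exact flagW_mem_layoutRegion kit.hN _ (by have := (SLP.bRot kit.k z sgn).compile_bounds kit.Wd 0 0; omega))
  -- the implementation bound
  have himpl := rotGadget_implOn_gen (c := kit.cr) (t := e 2) (Fz := rotFlag kit e q w z sgn) (as := kit.as) (region := kit.region)
    (hs := kit.hs) (rotOps kit e q w z sgn) (rotOps_wf hk hL hz hs) hk.nodup (hL.e_had 2) (fun h => hL.e_had 2 (h ▸ List.mem_cons_self ..))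
    ht2r hk.hs_len hk.hs_ne hk.hs_nodup (hk.hs_had _ · (by simp)) (hls hk) (hlsnd hk) (hwfR hk) hsw
    (fun bb x n => (SLP.bRot kit.k z sgn).eval (2 ^ kit.k * hiNum bb x (insRot e q w) + n))
    (fun x hx bb n hn => clEval_gadgetOps_flag G _ hok hR hF hmax hT (fun a ha => hx a (by
      rw [layoutRegion_useLayout] at ha; simp only [List.cons_append, List.mem_cons, List.mem_append]; exact Or.inr (Or.inr ha))) bb
      (by rw [hk.len] at hn; exact hn))
    U hUu hUt (show (0 : ℝ) ≤ 2 / 2 ^ kit.k by positivity) (fun bb x => by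
      rw [hk.len]
      have key := SLP.rotSign_entry_bound kit.k (SLP.ctlRotB_readsHigh kit.k z) hd h10 h01 (rot2x2 (rotAmpA z) ((sgn : ℝ) * rotAmpB z))
        (fun a b => by rw [rot2x2_apply_eq]) bb (x (e 2)) (bitsToNat ([q, w, e 0, e 1, e 3, e 4, e 5].map x))
      have e1 : ∀ n, (SLP.bRot kit.k z sgn).eval (2 ^ kit.k * hiNum bb x (insRot e q w) + n) =
          (SLP.rotSignB kit.k (SLP.ctlRotB kit.k z) pd p10 p01).eval (2 ^ kit.k * SLP.hiOf bb (x (e 2)) (bitsToNat ([q, w, e 0, e 1, e 3, e 4, e 5].map x)) + n) := by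
        intro n; rw [hb, insRot, hiNum_cons]
      have e2 : (SLP.ctlRotB kit.k z).eval (2 ^ (kit.k + 2) * bitsToNat ([q, w, e 0, e 1, e 3, e 4, e 5].map x)) = decide (x ∈ Sqw q w ∧ condOf z (x ∘ e)) :=
        ctlRotB_eval_condOf kit.k e q w x hz
      simp only [e1]
      rw [e2] at key
      have e3 : U x = (if decide (x ∈ Sqw q w ∧ condOf z (x ∘ e)) = true then rot2x2 (rotAmpA z) ((sgn : ℝ) * rotAmpB z)
          else (1 : Matrix (QReg 1) (QReg 1) ℂ)) := by simp only [hU, decide_eq_true_eq]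
      rw [e3]; exact key)
  have ht2 : e 2 ∉ kit.cr :: kit.as ++ kit.region := by
    rw [List.cons_append, List.mem_cons, List.mem_append, not_or, not_or]
    have h := hL.e_had 2; rw [List.mem_cons, not_or] at h
    exact ⟨h.1, h.2, ht2r⟩
  exact
    { implOn := himpl
      act_contr := isContraction_of_mem_unitaryGroup (QCircuit.toMatrix_mem_unitaryGroup_holds cliffordT_isUnitary_holds 0 _)
      ideal_contr := isContraction_ctrlGate (e 2) hUu hUt
      ideal_pres := (preservesSupp_ctrlGate ht2 U).inter (preservesSupp_ctrlGate (hL.e_hs 2) U)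
      err_nonneg := by show (0 : ℝ) ≤ rotErr kit.k; unfold rotErr; positivity }

/-! #### The phase word -/

/-- The flag program of the phase gadget of the letter. [folklore] -/
def phaseOps (kit : GadgetKit N) (e : Fin 6 ↪ Fin N) (q w : Fin N) (pos : Bool) : List (ClOp (Fin N)) :=
  gadgetOps kit.hN (kit.useLayout (insPhase kit e q w)) (SLP.bPhase kit.k pos) (Wd := kit.Wd)

/-- Its flag wire. [folklore] -/
def phaseFlag (kit : GadgetKit N) (e : Fin 6 ↪ Fin N) (q w : Fin N) (pos : Bool) : Fin N :=
  gadgetFlag kit.hN (kit.useLayout (insPhase kit e q w)) (SLP.bPhase kit.k pos) (Wd := kit.Wd)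

include hk hL in
/-- The phase flag program is well formed. [folklore] -/
theorem phaseOps_wf (pos : Bool) : ∀ op ∈ phaseOps kit e q w pos, op.WF := by
  obtain ⟨hnd, hhad, hlt, hlen, -⟩ := insPhase_ok hk hL
  exact gadgetOps_wf (gadgetLayout_useLayout hk hnd hhad hlt hlen) _ ((SLP.ok_letterProgram kit.k).2 pos)
    (hk.R_ge _ (bPhase_mem _ _)) (hk.F_ge _ (bPhase_mem _ _)) (hk.T_ge _ (bPhase_mem _ _))

/-- **The word of the phase gadget of the letter.** [cite: AharonovJonesLandau2009, Claim 4.1] -/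
def phaseWord (pos : Bool) : QCircuit cliffordT N :=
  oaaWordCircuit (phaseSandwichCircuit (kit.cr :: kit.as) (phaseOps kit e q w pos) (phaseOps_wf hk hL pos) [kit.cr] [phaseFlag kit e q w pos])
    (reflectCircuit kit.cr (kit.as ++ kit.region) kit.hs hk.hs_ne (hwfR hk))

/-- The phase gadget error. [folklore] -/
def phaseErr (k : ℕ) : ℝ := 9 * Real.sqrt (2 * (4 / 2 ^ k))

include hk hL in
/-- **The phase word is a good step** implementing `tgtPhase e q w ±` on `kit.P`.
[cite: AharonovJonesLandau2009, Claim 4.1 and Thm. 4.3] -/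
theorem phaseWord_good (pos : Bool) :
    (⟨(phaseWord hk hL pos).toMatrix 0, tgtPhase e q w pos, phaseErr kit.k⟩ : ApproxStep N).Good kit.P := by
  obtain ⟨hnd, hhad, hlt, hlen, hhs⟩ := insPhase_ok hk hL
  have G := gadgetLayout_useLayout hk hnd hhad hlt hlen
  have hok := (SLP.ok_letterProgram kit.k).2 pos
  have hR := hk.R_ge _ (bPhase_mem kit.k pos); have hF := hk.F_ge _ (bPhase_mem kit.k pos); have hT := hk.T_ge _ (bPhase_mem kit.k pos)
  have hmax := SLP.maxBnd_letterProgram_lt kit.k _ (bPhase_mem kit.k pos)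
  obtain ⟨hre, him⟩ := SLP.encodes_bPhase kit.k pos
  -- the unit scalar
  set u : QReg N → ℂ := fun x => if x ∈ Sqw q w ∧ ECond (x ∘ e) then ajlPhaseConst pos else 1 with hu
  have huu : ∀ x, ‖u x‖ = 1 := fun x => by simp only [hu]; split_ifs; exacts [norm_ajlPhaseConst pos, norm_one]
  have hd0 : ∀ x b, u (Function.update x kit.d0 b) = u x := fun x b => by
    have hq : Function.update x kit.d0 b q = x q := Function.update_of_ne hL.d0_q.symm ..
    have hw : Function.update x kit.d0 b w = x w := Function.update_of_ne hL.d0_w.symm ..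
    have he : Function.update x kit.d0 b ∘ e = x ∘ e := by
      funext j; exact Function.update_of_ne (fun h => hL.d0_e ⟨j, h⟩) ..
    simp only [hu, mem_Sqw, hq, hw, he]
  have hd0r : kit.d0 ∉ kit.region := not_mem_region_of_lt hk hk.d0_lt
  -- helpers avoid the sandwich
  have hsw : ∀ h ∈ kit.hs, h ∉ phaseSandwichWires (kit.cr :: kit.as) (phaseOps kit e q w pos) [kit.cr] [phaseFlag kit e q w pos] := by
    intro h hh hmem
    simp only [phaseSandwichWires, List.mem_append, List.mem_flatMap, List.mem_singleton] at hmem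
    rcases hmem with ((hm | ⟨op, hop, hx⟩) | hm) | hm
    · exact hk.hs_had h hh hm
    · rcases mem_of_mem_wiresOf_gadgetOps G _ hok hR hF hT hop hx with hr | hr | hr | hr
      · exact not_mem_region_of_lt hk (hk.hs_low h hh) hr
      · exact hk.hs_had h hh (List.mem_cons_of_mem _ hr)
      · exact hk.hs_had h hh (by rw [hr]; exact List.mem_cons_self ..)
      · exact hhs _ hr hh
    · exact hk.hs_had h hh (by rw [hm]; exact List.mem_cons_self ..)
    · exact not_mem_region_of_lt hk (hk.hs_low _ hh) (by
        rw [hm]; exact flagW_mem_layoutRegion kit.hN _ (by have := (SLP.bPhase kit.k pos).compile_bounds kit.Wd 0 0; omega))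
  -- the flag program never targets the selector wire (input `k`)
  have hrt : ∀ op ∈ phaseOps kit e q w pos, op.target ≠ kit.cr := by
    intro op hop
    have := gadgetOps_target_ne G _ hok hR hF hT (j := kit.k) (by omega) op hop
    rwa [G.iw_c, show finOf N kit.hN (kit.cr : ℕ) = kit.cr from Fin.ext (val_finOf_of_lt kit.hN kit.cr.2)] at this
  -- the implementation bound
  have himpl := phaseGadget_implOn_gen (r := kit.cr) (t := kit.d0) (Fz := phaseFlag kit e q w pos) (as := kit.as) (region := kit.region)
    (hs := kit.hs) (phaseOps kit e q w pos) (phaseOps_wf hk hL pos) hk.nodup hk.d0_notin hd0r hrt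
    hk.hs_len hk.hs_ne hk.hs_nodup (hk.hs_had _ · (by simp)) (hls hk) (hlsnd hk) (hwfR hk) hsw
    (fun rb x n => (SLP.bPhase kit.k pos).eval (2 ^ kit.k * hiNum rb x (insPhase kit e q w) + n))
    (fun x hx rb n hn => clEval_gadgetOps_flag G _ hok hR hF hmax hT (fun a ha => hx a (by
      rw [layoutRegion_useLayout] at ha; simp only [List.cons_append, List.mem_cons, List.mem_append]; exact Or.inr (Or.inr ha))) rb
      (by rw [hk.len] at hn; exact hn))
    u huu hd0 (show (0 : ℝ) ≤ 4 / 2 ^ kit.k by positivity) (fun x => by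
      rw [hk.len]
      have key := SLP.phaseSign_entry_bound kit.k (SLP.ctlPhaseB_readsHigh kit.k) hre him (x kit.d0) (bitsToNat ([q, w, e 0, e 1, e 2, e 3, e 4, e 5].map x))
      have e1 : ∀ (rb : Bool) (n : ℕ), (SLP.bPhase kit.k pos).eval (2 ^ kit.k * hiNum rb x (insPhase kit e q w) + n) =
          (SLP.phaseSignB kit.k (SLP.ctlPhaseB kit.k) (.not (SLP.thr4B kit.k)) (if pos then .not (SLP.thr5B kit.k) else SLP.thr5B kit.k)).eval
            (2 ^ kit.k * SLP.hiOf rb (x kit.d0) (bitsToNat ([q, w, e 0, e 1, e 2, e 3, e 4, e 5].map x)) + n) := by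
        intro rb n; rw [insPhase, hiNum_cons]; rfl
      have e2 : (SLP.ctlPhaseB kit.k).eval (2 ^ (kit.k + 2) * bitsToNat ([q, w, e 0, e 1, e 2, e 3, e 4, e 5].map x)) = decide (x ∈ Sqw q w ∧ ECond (x ∘ e)) := by
        rw [List.map, List.map, List.map, List.map, List.map, List.map, List.map, List.map, List.map, SLP.ctlPhaseB_eval]
        apply Bool.decide_congr; simp [and_assoc]
      simp only [e1]
      rw [e2] at key
      have e3 : u x = (if decide (x ∈ Sqw q w ∧ ECond (x ∘ e)) = true then ajlPhaseConst pos else 1) := by simp only [hu, decide_eq_true_eq]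
      rw [e3]; exact key)
  rw [ctrlGate_smul_one] at himpl
  exact
    { implOn := himpl
      act_contr := isContraction_of_mem_unitaryGroup (QCircuit.toMatrix_mem_unitaryGroup_holds cliffordT_isUnitary_holds 0 _)
      ideal_contr := isContraction_diagonal_of_norm_eq_one huu
      ideal_pres := preservesSupp_diagonal _ _
      err_nonneg := by show (0 : ℝ) ≤ phaseErr kit.k; unfold phaseErr; positivity }

/-! #### The letter -/

/-- `condOf 2 = Cond₂`, `condOf 3 = Cond₃` inside the targets. [folklore] -/
theorem tgtRot_condOf (sgn : ℝ) :
    tgtRot e q w 2 (condOf 2) sgn = tgtRot e q w 2 Cond₂ sgn ∧ tgtRot e q w 3 (condOf 3) sgn = tgtRot e q w 3 Cond₃ sgn := by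
  constructor <;> simp [tgtRot, condOf]

/-- **The circuit of the letter `σ^{±}` placed at `e`, controlled by `q ∧ w`**: the five gadget words
(`rot₂ᴴ`, `rot₃ᴴ`, phase, `rot₃`, `rot₂`, applied in this order). [cite: AharonovJonesLandau2009, Claim 4.1] -/
def letterCircuit (pos : Bool) : QCircuit cliffordT N :=
  ((((rotWord hk hL (z := 2) (sgn := -1) (Or.inl rfl) (Or.inr rfl)).append (rotWord hk hL (z := 3) (sgn := -1) (Or.inr rfl) (Or.inr rfl))).append
      (phaseWord hk hL pos)).append (rotWord hk hL (z := 3) (sgn := 1) (Or.inr rfl) (Or.inl rfl))).append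
    (rotWord hk hL (z := 2) (sgn := 1) (Or.inl rfl) (Or.inl rfl))

/-- The error of a letter. [folklore] -/
def letterErr (k : ℕ) : ℝ := 4 * rotErr k + phaseErr k

include hk hL in
/-- **The letter circuit implements the controlled local core gate** `condOn (Sqw q w) (placeGate e (ajlLocalCore ±))`
on inputs clean on the kit, up to `letterErr k = 4·9√(4/2^k) + 9√(8/2^k)`.
[cite: AharonovJonesLandau2009, Claim 4.1 and Thm. 4.3] -/
theorem letterCircuit_implOn (pos : Bool) :
    ImplOn kit.P ((letterCircuit hk hL pos).toMatrix 0) (condOn (Sqw q w) (placeGate e (ajlLocalCore pos))) (letterErr kit.k) := by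
  have h2p := rotWord_good hk hL (z := 2) (sgn := 1) (Or.inl rfl) (Or.inl rfl)
  have h3p := rotWord_good hk hL (z := 3) (sgn := 1) (Or.inr rfl) (Or.inl rfl)
  have hph := phaseWord_good hk hL pos
  have h3m := rotWord_good hk hL (z := 3) (sgn := -1) (Or.inr rfl) (Or.inr rfl)
  have h2m := rotWord_good hk hL (z := 2) (sgn := -1) (Or.inl rfl) (Or.inr rfl)
  have hprod := ImplOn.listProd (P := kit.P)
    (L := [⟨(rotWord hk hL (z := 2) (sgn := 1) (Or.inl rfl) (Or.inl rfl)).toMatrix 0, tgtRot e q w 2 (condOf 2) ((1 : ℤ) : ℝ), rotErr kit.k⟩,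
      ⟨(rotWord hk hL (z := 3) (sgn := 1) (Or.inr rfl) (Or.inl rfl)).toMatrix 0, tgtRot e q w 3 (condOf 3) ((1 : ℤ) : ℝ), rotErr kit.k⟩,
      ⟨(phaseWord hk hL pos).toMatrix 0, tgtPhase e q w pos, phaseErr kit.k⟩,
      ⟨(rotWord hk hL (z := 3) (sgn := -1) (Or.inr rfl) (Or.inr rfl)).toMatrix 0, tgtRot e q w 3 (condOf 3) ((-1 : ℤ) : ℝ), rotErr kit.k⟩,
      ⟨(rotWord hk hL (z := 2) (sgn := -1) (Or.inl rfl) (Or.inr rfl)).toMatrix 0, tgtRot e q w 2 (condOf 2) ((-1 : ℤ) : ℝ), rotErr kit.k⟩])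
    (by
      intro s hs
      simp only [List.mem_cons, List.not_mem_nil, or_false] at hs
      rcases hs with rfl | rfl | rfl | rfl | rfl
      exacts [h2p, h3p, hph, h3m, h2m])
  simp only [List.map_cons, List.map_nil, List.prod_cons, List.prod_nil, Matrix.mul_one, List.sum_cons, List.sum_nil, add_zero] at hprod
  obtain ⟨c2, c3⟩ := tgtRot_condOf (e := e) (q := q) (w := w) (1 : ℝ)
  obtain ⟨c2', c3'⟩ := tgtRot_condOf (e := e) (q := q) (w := w) (-1 : ℝ)
  have hT : tgtRot e q w 2 Cond₂ 1 * (tgtRot e q w 3 Cond₃ 1 * (tgtPhase e q w pos * (tgtRot e q w 3 Cond₃ (-1) * tgtRot e q w 2 Cond₂ (-1)))) =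
      condOn (Sqw q w) (placeGate e (ajlLocalCore pos)) := by
    simpa only [Matrix.mul_assoc] using letterTargets_prod hL.q_e hL.w_e (e := e) pos
  rw [Int.cast_one, Int.cast_neg, Int.cast_one, c2, c3, c2', c3', hT] at hprod
  have hM : (letterCircuit hk hL pos).toMatrix 0 =
      (rotWord hk hL (z := 2) (sgn := 1) (Or.inl rfl) (Or.inl rfl)).toMatrix 0 * ((rotWord hk hL (z := 3) (sgn := 1) (Or.inr rfl) (Or.inl rfl)).toMatrix 0 *
        ((phaseWord hk hL pos).toMatrix 0 * ((rotWord hk hL (z := 3) (sgn := -1) (Or.inr rfl) (Or.inr rfl)).toMatrix 0 *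
          (rotWord hk hL (z := 2) (sgn := -1) (Or.inl rfl) (Or.inr rfl)).toMatrix 0))) := by
    rw [letterCircuit, QCircuit.toMatrix_append, QCircuit.toMatrix_append, QCircuit.toMatrix_append, QCircuit.toMatrix_append]
  rw [hM]
  have herr : letterErr kit.k = rotErr kit.k + (rotErr kit.k + (phaseErr kit.k + (rotErr kit.k + rotErr kit.k))) := by unfold letterErr; ring
  rw [herr]
  exact hprod

end Letter

end GadgetKit

end Literature.Computability.QuantumComplexity

end
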